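import Literature.NumberTheory.LFunctions.MoebiusWalshLocalised
import Literature.NumberTheory.LFunctions.MoebiusWalshVaughan
import Literature.NumberTheory.Sieve.VinogradovExpSumTools
import HarnessLib

/-!
# Bourgain 2013, §3: the type-I estimate for Walsh box sums — proved (mollifier-free form)

Topic `Literature/NumberTheory/LFunctions`, a proofs companion of `MoebiusWalshCircuits.lean`
(named facts `bourgain_moebius_walsh_uniform`, `bourgain_liouville_walsh_uniform`: J. Bourgain,
*Möbius–Walsh correlation bounds and an estimate of Mauduit and Rivat*, J. Anal. Math. **119**
(2013) 147–163 = arXiv:1109.2784 [Bourgain2013MoebiusWalsh], Theorem 1). Everything in this file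
is PROVED (theorems only); no definition, no named fact.

It supplies the analytic TYPE-I estimate of §3 of the paper — the bound for
`∑_{m ∼ M} |∑_{n ∼ N} w_S(mn)|` ((3.1)), `M = 2^μ` small — for the dyadic box sums produced by
the tree's Vaughan reduction
(`Literature.NumberTheory.LFunctions.MoebiusWalshVaughan.abs_walshSum_moebius_le_boxes`:
`boxSum T i j (typeICoeff u) 1 = ∑_{a ∈ D_i} c(a) ∑_{b ∈ D_j} w_T(ab)`, `D_i = [2^i, 2^{i+1})`,
`w_T = natWalsh T`, `|c| ≤ τ`), covering BOTH regimes of the printed proof with one statement: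

* the crude bound (3.2)–(3.3), `(3.1) ≲ N M² λ² ‖ŵ_S‖_∞`, i.e. a relative saving `≍ M λ 2^{-c|S|}`;
* the refined bound (3.5)–(3.9): with the digit set split at height `λ - 2μ` into `S₁ ∪ S₂`,
  `(3.1) ≲ μ · (ℓ¹-mass of ŵ_{S₂}) · ‖ŵ_{S₁}‖_∞ · MN`, a relative saving WITHOUT the factor `M`,
  paid for by the `ℓ¹` norm of the coefficients of the few top digits `S₂`.

## What is proved (namespace `Literature.NumberTheory.LFunctions.MoebiusWalsh`)

For a digit set `T ⊆ [0, Λ)` (`T : Finset ℕ`), a cut `Λ₁`, `T₁ = T ∩ [0, Λ₁)`, `T₂ = T ∩ [Λ₁, Λ)`,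
`P₁ = 2^{Λ₁}`, `P = 2^Λ`, and every box `D_i × D_j`:

* `typeI_master`:
  `∑_{a ∈ D_i} |∑_{b ∈ D_j} w_T(ab)| ≤ 2·2^{-c₂|T₁|} · (∑_{k<P} |ŵ_{T₂}(k/P)|) · (2^{i+j+1}(i+1) + 2^i P₁ (1 + log P₁))`
  (`c₂ = walshSupExponent = log₂(27/16)/4`, the exponent of the tree's Lemma 2);
* `typeI_bound`: the same with the tree's Lemma 1, `∑_k |ŵ_{T₂}(k/P)| ≤ (2Λ)^{|T₂|}`;
* `typeI_crude` (cut `Λ₁ = Λ`, `T₂ = ∅`) and `typeI_refined` (cut `Λ₁ = j - i`, `P₁ = N/M`), the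
  two printed regimes;
* `abs_boxSum_typeI_le`: the divisor-bounded coefficient of the Vaughan type-I box is removed by
  Cauchy–Schwarz and `∑_{a ≤ 2^{i+1}} τ(a)² ≤ 2^{i+1}(1 + log 2^{i+1})³` (tree):
  `|boxSum T i j c 1| ≤ √(2^{i+1}(1+log 2^{i+1})³) √(2^j F)` for any bound `F` of the above sums;
* tools: `sum_geomBound_progression_le` (`∑_{k mod 2^p} min(N, 1/(2‖ak/2^p + β‖)) ≤ 2N gcd(a,2^p) + 2^p(1 + log 2^p)`),
  `sum_dyBlock_gcd_two_pow_le` (`∑_{a ∈ D_i} gcd(a, 2^p) ≤ (i+1)2^i`), `typeI_abstract` (the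
  inequality for a product of two periodic functions with given Fourier expansions),
  `natWalsh_eq_walshNat` / `natWalsh_eq_sum_range` (bridge from `MoebiusWalshVaughan.natWalsh`,
  `Finset ℕ`-indexed, to `MoebiusWalsh.walshNat` and its Fourier inversion),
  `norm_walshCoeff_le_two_mul_rpow` (Lemma 2 with the explicit exponent).

## Derivation (a shorter road than the printed one)

The paper mollifies the `n`-summation ((3.2): "using a suitable mollifier … `+ o(1)`") and, in
the refined regime, truncates the Fourier series of the top digits ((3.5)–(3.7),
`|𝒜₂| < 2^{H|S₂|}`, error `O_{L¹}(2^{-H})`). Neither is needed: pointwise `w_T = w_{T₁} · w_{T₂}`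
(`natWalsh_eq_mul_filter`); `w_{T₁}` is `P₁`-periodic and `w_{T₂}` is `P`-periodic, so Fourier
inversion on `ℤ/P₁` and on `ℤ/P` (tree: `walshNat_eq_sum_range`) gives
`∑_b w_T(ab) = ∑_{k₂} ŵ_{T₂}(k₂/P) ∑_{k₁} ŵ_{T₁}(k₁/P₁) ∑_{b ∈ D_j} e(-(k₁/P₁ + k₂/P)ab)`, whence

  `∑_a |∑_b w_T(ab)| ≤ ‖ŵ_{T₂}‖_{ℓ¹} ‖ŵ_{T₁}‖_∞ sup_{k₂} ∑_{a ∈ D_i} ∑_{k₁ mod P₁} min(N, 1/(2‖ak₁/P₁ + ak₂/P‖))`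

(`typeI_abstract`, geometric sums by Nathanson's Lemma 4.7 in the tree's form
`Literature.NumberTheory.Sieve.Vinogradov.norm_sum_Ioc_fourierChar_le_geomBound`). The double sum is
estimated by pair counting on the frequency group, uniformly in the shift: for fixed `a` with
`g = gcd(a, P₁)` the points `ak₁/P₁ + β`, `k₁ mod P₁`, are `g` copies of `P₁/g` points pairwise
`(g/P₁)`-separated modulo `1`, so the tree's well-spacing lemma
(`Literature.NumberTheory.Sieve.Vinogradov.sum_geomBound_le_of_separated`, Nathanson Lemmas 4.8–4.9)
gives `≤ 2Ng + P₁(1 + log P₁)` (`sum_geomBound_progression_le`), and `∑_{a ∈ D_i} gcd(a, P₁) ≤ (i+1)2^i`.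
This is exactly the printed count "`∑_{m∼M} |{k₁ : k₁m ≡ 0 (mod 2^{λ-2μ})}| ≲ μM`" below (3.8),
now valid on every dyadic layer of `‖·‖`, which is why no mollifier and no error terms appear.

## How the assembly (§3 of the paper) is meant to use it

For a type-I box with `M = 2^i ≤ u²`, `N = 2^j`, `MN ≍ 2^Λ`, digit set `T` (`|T| > λ^{1/2}/H`):
the cut `Λ₁ = Λ` gives the relative saving `≍ M Λ 2^{-c₂|T|}`, conclusive for `M ≤ 2^{c₂|T|/2}`
(the printed range "`M < C^H`", (3.3)); the cut `Λ₁ = j - i` gives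
`≍ (i + Λ)(2Λ)^{|T ∩ [j-i, Λ)|} 2^{-c₂ |T ∩ [0, j-i)|}`, conclusive when the top `Λ - j + i ≈ 2μ`
digits carry few (`≪ |T|/log Λ`) elements of `T` (the printed hypothesis (3.4)); in the remaining
case a window of length `μ` at the top of the digit range carries many elements of `T`, and the box
is treated as a TYPE-II sum (§2 of the paper, (2.35); not in this file) through
`∑_a τ(a)|F_a| ≤ (∑ τ²)^{1/2} (N ∑_a |F_a|)^{1/2}` and `∑_a |F_a| = ∑_a ε_a F_a` with signs `ε_a`.

## References

* J. Bourgain, *Möbius–Walsh correlation bounds and an estimate of Mauduit and Rivat*, J. Anal.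
  Math. 119 (2013) 147–163; arXiv:1109.2784: §3, (3.1)–(3.9). [Bourgain2013MoebiusWalsh]
* M. B. Nathanson, *Additive Number Theory: the Classical Bases*, GTM 164 (1996), §4.4,
  Lemmas 4.7–4.9 [Nathanson1996] — geometric sums and well-spaced points, through the tree's
  `Literature/NumberTheory/Sieve/VinogradovExpSumTools.lean`.
-/

noncomputable section

open Finset Real
open Literature.Computability.Complexity
open Literature.NumberTheory.Sieve.Vinogradov (distInt distInt_nonneg distInt_add_int geomBound
  geomBound_le geomBound_nonneg geomBound_neg geomBound_mono sum_geomBound_le_of_separated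
  norm_sum_Ioc_fourierChar_le_geomBound)
open Literature.NumberTheory.LFunctions.MoebiusWalshVaughan (natWalsh dyBlock mem_dyBlock boxSum)

namespace Literature.NumberTheory.LFunctions.MoebiusWalsh

/-! ### Local helpers (distance to the nearest integer, geometric sums over a block)

These four small facts also exist, in slightly different normal forms, in the sibling tools file
`MoebiusWalshGeomSums.lean` (landed concurrently); they are kept `private` here so that this file
does not depend on it. -/

/-- A rational number `u/Q` which is not an integer is at distance `≥ 1/Q` from `ℤ`. [folklore] -/
private theorem one_div_le_distInt_of_not_dvd {u : ℤ} {Q : ℕ} (hQ : 0 < Q) (h : ¬ (Q : ℤ) ∣ u) :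
    1 / (Q : ℝ) ≤ distInt ((u : ℝ) / Q) := by
  unfold distInt
  set n : ℤ := round ((u : ℝ) / Q) with hn
  have hQ0 : (0 : ℝ) < Q := by exact_mod_cast hQ
  have hne : u - Q * n ≠ 0 := by
    intro h0
    exact h ⟨n, by linarith⟩
  have h1 : (1 : ℝ) ≤ |((u - Q * n : ℤ) : ℝ)| := by exact_mod_cast Int.one_le_abs hne
  have h2 : (u : ℝ) / Q - n = ((u - Q * n : ℤ) : ℝ) / Q := by
    push_cast; field_simp
  rw [h2, abs_div, abs_of_pos hQ0]
  exact div_le_div_of_nonneg_right h1 hQ0.le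

/-- `min(V, 1/(2‖x‖))` is `1`-periodic. [folklore] -/
private theorem geomBound_add_int (V x : ℝ) (n : ℤ) : geomBound V (x + n) = geomBound V x := by
  unfold geomBound
  rw [distInt_add_int]

/-- A block sum of characters is a shifted initial sum: `∑_{b ∈ [b₀, b₀+L)} e(tb) = e(tb₀) ∑_{m<L} e(tm)`.
[folklore] -/
private theorem sum_Ico_eChar_eq (b₀ L : ℕ) (t : ℝ) :
    ∑ b ∈ Ico b₀ (b₀ + L), eChar (t * b) = eChar (t * b₀) * ∑ m ∈ range L, eChar (t * m) := by
  rw [Finset.sum_Ico_eq_sum_range, Nat.add_sub_cancel_left, Finset.mul_sum]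
  refine Finset.sum_congr rfl fun m _ => ?_
  rw [← eChar_add]; push_cast; ring_nf

/-- `‖∑_{b ∈ [b₀, b₀ + L)} e(tb)‖ ≤ min(L, 1/(2‖t‖))` (Nathanson, Lemma 4.7, for the character `eChar`
and a block `Ico`). [cite: Nathanson1996, §4.4, Lemma 4.7] -/
private theorem norm_sum_Ico_eChar_le_geomBound' (t : ℝ) (b₀ L : ℕ) :
    ‖∑ b ∈ Ico b₀ (b₀ + L), eChar (t * b)‖ ≤ geomBound L t := by
  have h2 := norm_sum_Ioc_fourierChar_le_geomBound (a := 0) (b := L) (V := L) t (by simp)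
  have hI : Ioc 0 L = Ico 1 (1 + L) := by ext n; simp only [Finset.mem_Ioc, Finset.mem_Ico]; omega
  have h3 : ‖∑ n ∈ Ioc 0 L, (Real.fourierChar ((n : ℝ) * t) : ℂ)‖ =
      ‖∑ m ∈ range L, eChar (t * m)‖ := by
    have h4 : ∑ n ∈ Ioc 0 L, (Real.fourierChar ((n : ℝ) * t) : ℂ) = ∑ n ∈ Ico 1 (1 + L), eChar (t * n) := by
      rw [hI]
      refine Finset.sum_congr rfl fun n _ => ?_
      rw [← eChar_eq_fourierChar, mul_comm]
    rw [h4, sum_Ico_eChar_eq, norm_mul, norm_eChar, one_mul]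
  rw [sum_Ico_eChar_eq, norm_mul, norm_eChar, one_mul, ← h3]
  exact h2

/-! ### Pair counting on the frequency group `ℤ/2^p` -/

/-- **The frequencies `ak/P + β`, `k mod P`, against `min(N, 1/(2‖·‖))`.** For `P = 2^p`,
`a ≥ 1`, `g = gcd(a, P)`, every real shift `β` and `N ≥ 0`:
`∑_{k < P} min(N, 1/(2‖ak/P + β‖)) ≤ 2N g + P (1 + log P)`.
(The `P` frequencies form `g` translates of the `P/g` points `a'r/(P/g) + β`, `a' = a/g` coprime
to `P/g`, which are pairwise `(g/P)`-separated modulo `1`; then Nathanson's Lemmas 4.8–4.9 in the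
tree's well-spaced form. The same count as `sum_range_geomBound_mul_div_le` of the sibling
`MoebiusWalshGeomSums.lean` (there with `2^{v₂(a)+1}V`), here through `gcd(a, P)`.) [folklore] -/
theorem sum_geomBound_progression_le {a : ℕ} (ha : 0 < a) (p : ℕ) (β : ℝ) {N : ℝ} (hN : 0 ≤ N) :
    ∑ k ∈ range (2 ^ p), geomBound N ((a * k : ℕ) / ((2 ^ p : ℕ) : ℝ) + β) ≤
      2 * N * Nat.gcd a (2 ^ p) + (2 ^ p : ℕ) * (1 + Real.log (2 ^ p : ℕ)) := by
  set P : ℕ := 2 ^ p with hP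
  set g : ℕ := Nat.gcd a P with hg
  have hP0 : 0 < P := Nat.two_pow_pos p
  have hg0 : 0 < g := Nat.gcd_pos_of_pos_left _ ha
  obtain ⟨a', ha'⟩ : g ∣ a := Nat.gcd_dvd_left a P
  obtain ⟨P', hP'⟩ : g ∣ P := Nat.gcd_dvd_right a P
  have hgP' : 0 < g * P' := hP' ▸ hP0
  have hP'0 : 0 < P' := Nat.pos_of_mul_pos_left hgP'
  have hcop : Nat.Coprime a' P' := by
    have h := Nat.coprime_div_gcd_div_gcd (m := a) (n := P) hg0
    have e1 : a / Nat.gcd a P = a' := by rw [← hg, ha', Nat.mul_div_cancel_left _ hg0]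
    have e2 : P / Nat.gcd a P = P' := by rw [← hg, hP', Nat.mul_div_cancel_left _ hg0]
    rwa [e1, e2] at h
  have hgR : (g : ℝ) ≠ 0 := by exact_mod_cast hg0.ne'
  have hP'R : (P' : ℝ) ≠ 0 := by exact_mod_cast hP'0.ne'
  -- the summand only depends on `k mod P'`, through `a' k / P'`
  have hterm : ∀ k : ℕ, geomBound N ((a * k : ℕ) / (P : ℝ) + β) =
      geomBound N ((a' * k : ℕ) / (P' : ℝ) + β) := by
    intro k
    congr 2
    rw [ha', hP']
    push_cast
    field_simp
  have hshift : ∀ m k : ℕ, geomBound N ((a' * (k + P' * m) : ℕ) / (P' : ℝ) + β) =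
      geomBound N ((a' * k : ℕ) / (P' : ℝ) + β) := by
    intro m k
    have : ((a' * (k + P' * m) : ℕ) : ℝ) / (P' : ℝ) + β =
        ((a' * k : ℕ) : ℝ) / (P' : ℝ) + β + ((a' * m : ℕ) : ℤ) := by
      push_cast; field_simp; ring
    rw [this, geomBound_add_int]
  -- split `range P = range (P' * g)` into `g` blocks
  have hsplit : ∑ k ∈ range P, geomBound N ((a * k : ℕ) / (P : ℝ) + β) =
      g * ∑ k ∈ range P', geomBound N ((a' * k : ℕ) / (P' : ℝ) + β) := by
    simp_rw [hterm]
    rw [show P = P' * g by rw [hP', mul_comm], sum_range_mul_eq_sum_sum _ P' g]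
    simp_rw [hshift]
    rw [Finset.sum_const, Finset.card_range, nsmul_eq_mul]
  rw [hsplit]
  -- the `P'` points are pairwise `1/P'`-separated
  have hsep : ∀ k ∈ range P', ∀ k' ∈ range P', k ≠ k' →
      1 / (P' : ℝ) ≤ distInt (((a' * k : ℕ) / (P' : ℝ) + β) - ((a' * k' : ℕ) / (P' : ℝ) + β)) := by
    intro k hk k' hk' hkk'
    rw [Finset.mem_range] at hk hk'
    have h1 : ((a' * k : ℕ) / (P' : ℝ) + β) - ((a' * k' : ℕ) / (P' : ℝ) + β) =
        (((a' : ℤ) * ((k : ℤ) - k') : ℤ) : ℝ) / P' := by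
      push_cast; ring
    rw [h1]
    refine one_div_le_distInt_of_not_dvd hP'0 ?_
    intro hdvd
    have hcopZ : IsCoprime (P' : ℤ) (a' : ℤ) := Nat.isCoprime_iff_coprime.mpr hcop.symm
    have h2 : (P' : ℤ) ∣ (k : ℤ) - k' := hcopZ.dvd_of_dvd_mul_left hdvd
    have h3 : |(k : ℤ) - k'| < P' := by
      rw [abs_lt]; constructor <;> omega
    have h4 : (k : ℤ) - k' = 0 := Int.eq_zero_of_abs_lt_dvd h2 h3
    exact hkk' (by exact_mod_cast (sub_eq_zero.mp h4))
  have hws := sum_geomBound_le_of_separated (range P')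
    (fun k : ℕ => (a' * k : ℕ) / (P' : ℝ) + β) (δ := 1 / (P' : ℝ)) (by positivity) (m := P')
    (by rw [mul_one_div, one_div_div]; linarith [(show (0 : ℝ) < P' by exact_mod_cast hP'0)]) hsep hN
  have hlogP' : Real.log P' ≤ Real.log P := by
    refine Real.log_le_log (by exact_mod_cast hP'0) ?_
    have : P' ≤ P := by rw [hP']; exact Nat.le_mul_of_pos_left _ hg0
    exact_mod_cast this
  have hlogP'0 : 0 ≤ 1 + Real.log P' := by
    have := Real.log_nonneg (show (1 : ℝ) ≤ P' by exact_mod_cast hP'0); linarith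
  calc (g : ℝ) * ∑ k ∈ range P', geomBound N ((a' * k : ℕ) / (P' : ℝ) + β)
      ≤ g * (2 * N + 1 / (1 / (P' : ℝ)) * (1 + Real.log P')) := by gcongr
    _ = 2 * N * g + ((g * P' : ℕ) : ℝ) * (1 + Real.log P') := by
        rw [one_div_one_div]; push_cast; ring
    _ = 2 * N * g + P * (1 + Real.log P') := by rw [← hP']
    _ ≤ 2 * N * g + P * (1 + Real.log P) := by gcongr

/-- **`gcd` with a power of two along a dyadic block**: `∑_{a ∈ [2^i, 2^{i+1})} gcd(a, 2^p) ≤ (i+1) 2^i`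
(the elements divisible by `2^v`, `v ≤ i`, number `≤ 2^{i-v}`, and `gcd(a, 2^p) = 2^v ≤ ∑_{w ≤ i, 2^w ∣ a} 2^w`).
[folklore] -/
theorem sum_dyBlock_gcd_two_pow_le (i p : ℕ) :
    ∑ a ∈ dyBlock i, (Nat.gcd a (2 ^ p) : ℝ) ≤ (i + 1) * 2 ^ i := by
  -- `gcd(a, 2^p) ≤ ∑_{v ≤ i, 2^v ∣ a} 2^v` for `1 ≤ a < 2^{i+1}`
  have hpt : ∀ a ∈ dyBlock i, (Nat.gcd a (2 ^ p) : ℝ) ≤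
      ∑ v ∈ range (i + 1), if 2 ^ v ∣ a then (2 : ℝ) ^ v else 0 := by
    intro a ha
    rw [mem_dyBlock] at ha
    have ha0 : 0 < a := lt_of_lt_of_le (Nat.two_pow_pos i) ha.1
    obtain ⟨v, -, hv⟩ := (Nat.dvd_prime_pow Nat.prime_two).1 (Nat.gcd_dvd_right a (2 ^ p))
    have hva : 2 ^ v ∣ a := hv ▸ Nat.gcd_dvd_left a (2 ^ p)
    have hvi : v < i + 1 := by
      have h1 : 2 ^ v ≤ a := Nat.le_of_dvd ha0 hva
      have h2 : 2 ^ v < 2 ^ (i + 1) := lt_of_le_of_lt h1 ha.2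
      exact (Nat.pow_lt_pow_iff_right (by norm_num)).1 h2
    rw [hv]
    have hsingle : ((2 ^ v : ℕ) : ℝ) = ∑ w ∈ ({v} : Finset ℕ), if 2 ^ w ∣ a then (2 : ℝ) ^ w else 0 := by
      rw [Finset.sum_singleton, if_pos hva]; push_cast; ring
    rw [hsingle]
    refine Finset.sum_le_sum_of_subset_of_nonneg (by simpa using hvi) fun w _ _ => ?_
    split_ifs <;> positivity
  refine (Finset.sum_le_sum hpt).trans ?_
  rw [Finset.sum_comm]
  -- for each `v ≤ i`, the multiples of `2^v` in `D_i` number at most `2^{i-v}`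
  have hcount : ∀ v ∈ range (i + 1),
      ∑ a ∈ dyBlock i, (if 2 ^ v ∣ a then (2 : ℝ) ^ v else 0) ≤ 2 ^ i := by
    intro v hv
    rw [Finset.mem_range] at hv
    rw [← Finset.sum_filter, Finset.sum_const, nsmul_eq_mul]
    have hcard : ((dyBlock i).filter (fun a => 2 ^ v ∣ a)).card ≤ 2 ^ (i - v) := by
      have hinj : ((dyBlock i).filter (fun a => 2 ^ v ∣ a)).card ≤
          (Ico (2 ^ (i - v)) (2 ^ (i - v + 1))).card := by
        refine Finset.card_le_card_of_injOn (fun a => a / 2 ^ v) ?_ ?_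
        · intro a ha
          rw [Finset.mem_coe, Finset.mem_filter, mem_dyBlock] at ha
          obtain ⟨⟨h1, h2⟩, ⟨c, hc⟩⟩ := ha
          subst hc
          dsimp only
          rw [Finset.mem_coe, Finset.mem_Ico, Nat.mul_div_cancel_left _ (Nat.two_pow_pos v)]
          have e1 : 2 ^ i = 2 ^ v * 2 ^ (i - v) := by rw [← pow_add]; congr 1; omega
          have e2 : 2 ^ (i + 1) = 2 ^ v * 2 ^ (i - v + 1) := by rw [← pow_add]; congr 1; omega
          rw [e1] at h1
          rw [e2] at h2
          exact ⟨Nat.le_of_mul_le_mul_left h1 (Nat.two_pow_pos v),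
            Nat.lt_of_mul_lt_mul_left h2⟩
        · intro a ha b hb hab
          rw [Finset.mem_coe, Finset.mem_filter] at ha hb
          obtain ⟨c, hc⟩ := ha.2
          obtain ⟨d, hd⟩ := hb.2
          simp only at hab
          rw [hc, hd, Nat.mul_div_cancel_left _ (Nat.two_pow_pos v),
            Nat.mul_div_cancel_left _ (Nat.two_pow_pos v)] at hab
          rw [hc, hd, hab]
      have hc2 : (Ico (2 ^ (i - v)) (2 ^ (i - v + 1))).card = 2 ^ (i - v) := by
        rw [Nat.card_Ico, pow_succ]; omega
      exact hinj.trans hc2.le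
    calc (((dyBlock i).filter (fun a => 2 ^ v ∣ a)).card : ℝ) * 2 ^ v
        ≤ (2 : ℝ) ^ (i - v) * 2 ^ v := by gcongr; exact_mod_cast hcard
      _ = 2 ^ i := by rw [← pow_add]; congr 1; omega
  calc ∑ v ∈ range (i + 1), ∑ a ∈ dyBlock i, (if 2 ^ v ∣ a then (2 : ℝ) ^ v else 0)
      ≤ ∑ _v ∈ range (i + 1), (2 : ℝ) ^ i := Finset.sum_le_sum hcount
    _ = (i + 1) * 2 ^ i := by rw [Finset.sum_const, Finset.card_range, nsmul_eq_mul]; push_cast; ring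

/-- **The double frequency sum of a type-I box**: for `a ∈ D_i`, frequencies `k₁ mod 2^p` with
an arbitrary shift `γ(a)`, and `N ≥ 0`,
`∑_{a ∈ D_i} ∑_{k₁ < 2^p} min(N, 1/(2‖ak₁/2^p + γ(a)‖)) ≤ 2N(i+1)2^i + 2^i · 2^p (1 + log 2^p)`.
[folklore] -/
theorem sum_dyBlock_sum_geomBound_le (i p : ℕ) (γ : ℕ → ℝ) {N : ℝ} (hN : 0 ≤ N) :
    ∑ a ∈ dyBlock i, ∑ k ∈ range (2 ^ p), geomBound N ((a * k : ℕ) / ((2 ^ p : ℕ) : ℝ) + γ a) ≤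
      2 * N * ((i + 1) * 2 ^ i) + 2 ^ i * ((2 ^ p : ℕ) * (1 + Real.log (2 ^ p : ℕ))) := by
  have h1 : ∀ a ∈ dyBlock i, ∑ k ∈ range (2 ^ p), geomBound N ((a * k : ℕ) / ((2 ^ p : ℕ) : ℝ) + γ a) ≤
      2 * N * Nat.gcd a (2 ^ p) + (2 ^ p : ℕ) * (1 + Real.log (2 ^ p : ℕ)) := by
    intro a ha
    have ha' := mem_dyBlock.mp ha
    exact sum_geomBound_progression_le (lt_of_lt_of_le (Nat.two_pow_pos i) ha'.1) p (γ a) hN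
  refine (Finset.sum_le_sum h1).trans ?_
  rw [Finset.sum_add_distrib, Finset.sum_const, nsmul_eq_mul]
  have hcard : ((dyBlock i).card : ℝ) = 2 ^ i := by
    have : 2 ^ (i + 1) - 2 ^ i = 2 ^ i := by rw [pow_succ]; omega
    rw [dyBlock, Nat.card_Ico, this]; push_cast; ring
  rw [hcard]
  have hsum : ∑ a ∈ dyBlock i, 2 * N * (Nat.gcd a (2 ^ p) : ℝ) =
      2 * N * ∑ a ∈ dyBlock i, (Nat.gcd a (2 ^ p) : ℝ) := by rw [Finset.mul_sum]
  rw [hsum]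
  gcongr
  exact sum_dyBlock_gcd_two_pow_le i p

/-! ### The abstract type-I inequality -/

/-- **Type-I sums of a product of two periodic functions, abstract form.** If
`f₁(x) = ∑_{k<P₁} c₁(k) e(-kx/P₁)` and `f₂(x) = ∑_{k<P} c₂(k) e(-kx/P)` for all `x ∈ ℕ`, with
`|c₁| ≤ B₁`, then for every finite set `𝒜` of multipliers and every block `[b₀, b₀ + L)`, `L ≤ N`,
`∑_{a ∈ 𝒜} |∑_b f₁(ab) f₂(ab)| ≤ B₁ · ‖c₂‖₁ · W` as soon as
`∑_{a ∈ 𝒜} ∑_{k₁<P₁} min(N, 1/(2‖ak₁/P₁ + ak₂/P‖)) ≤ W` for every `k₂ < P`.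
[cite: Bourgain2013MoebiusWalsh, §3 (3.2), (3.7)–(3.8) (rendered without mollifier)] -/
theorem typeI_abstract {f₁ f₂ : ℕ → ℝ} {P₁ P : ℕ} {c₁ c₂ : ℕ → ℂ} {B₁ W N : ℝ} (𝒜 : Finset ℕ)
    (b₀ L : ℕ)
    (hf₁ : ∀ x : ℕ, (f₁ x : ℂ) = ∑ k ∈ range P₁, c₁ k * eChar (-(k * ((x : ℝ) / P₁))))
    (hf₂ : ∀ x : ℕ, (f₂ x : ℂ) = ∑ k ∈ range P, c₂ k * eChar (-(k * ((x : ℝ) / P))))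
    (hB₁0 : 0 ≤ B₁) (hB₁ : ∀ k ∈ range P₁, ‖c₁ k‖ ≤ B₁) (hL : (L : ℝ) ≤ N)
    (hW : ∀ k₂ ∈ range P, ∑ a ∈ 𝒜, ∑ k₁ ∈ range P₁,
      geomBound N ((a * k₁ : ℕ) / (P₁ : ℝ) + (a * k₂ : ℕ) / (P : ℝ)) ≤ W) :
    ∑ a ∈ 𝒜, |∑ b ∈ Ico b₀ (b₀ + L), f₁ (a * b) * f₂ (a * b)| ≤
      B₁ * (∑ k ∈ range P, ‖c₂ k‖) * W := by
  -- the phase of the pair `(k₁, k₂)` at the multiplier `a`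
  set θ : ℕ → ℕ → ℕ → ℝ := fun a k₁ k₂ => (a * k₁ : ℕ) / (P₁ : ℝ) + (a * k₂ : ℕ) / (P : ℝ) with hθ
  -- Step 1: expand `∑_b f₁ f₂` for a fixed `a`
  have hexp : ∀ a : ℕ, ((∑ b ∈ Ico b₀ (b₀ + L), f₁ (a * b) * f₂ (a * b) : ℝ) : ℂ) =
      ∑ k₂ ∈ range P, c₂ k₂ * ∑ k₁ ∈ range P₁, c₁ k₁ *
        ∑ b ∈ Ico b₀ (b₀ + L), eChar ((-(θ a k₁ k₂)) * b) := by
    intro a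
    push_cast
    have hb : ∀ b : ℕ, (f₁ (a * b) : ℂ) * (f₂ (a * b) : ℂ) =
        ∑ k₂ ∈ range P, ∑ k₁ ∈ range P₁,
          c₂ k₂ * (c₁ k₁ * eChar ((-(θ a k₁ k₂)) * b)) := by
      intro b
      rw [hf₁ (a * b), hf₂ (a * b), Finset.sum_mul_sum, Finset.sum_comm]
      refine Finset.sum_congr rfl fun k₂ _ => Finset.sum_congr rfl fun k₁ _ => ?_
      rw [show c₁ k₁ * eChar (-(k₁ * (((a * b : ℕ) : ℝ) / P₁))) *
          (c₂ k₂ * eChar (-(k₂ * (((a * b : ℕ) : ℝ) / P)))) =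
          c₂ k₂ * (c₁ k₁ * (eChar (-(k₁ * (((a * b : ℕ) : ℝ) / P₁))) *
            eChar (-(k₂ * (((a * b : ℕ) : ℝ) / P))))) by ring, ← eChar_add]
      congr 3
      simp only [hθ]; push_cast; ring
    simp_rw [hb]
    rw [Finset.sum_comm]
    refine Finset.sum_congr rfl fun k₂ _ => ?_
    rw [Finset.sum_comm, Finset.mul_sum]
    refine Finset.sum_congr rfl fun k₁ _ => ?_
    rw [Finset.mul_sum, Finset.mul_sum]
  -- Step 2: bound for a fixed `a`
  have hfix : ∀ a : ℕ, |∑ b ∈ Ico b₀ (b₀ + L), f₁ (a * b) * f₂ (a * b)| ≤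
      B₁ * ∑ k₂ ∈ range P, ‖c₂ k₂‖ * ∑ k₁ ∈ range P₁, geomBound N (θ a k₁ k₂) := by
    intro a
    rw [← Real.norm_eq_abs, ← Complex.norm_real, hexp a]
    calc ‖∑ k₂ ∈ range P, c₂ k₂ * ∑ k₁ ∈ range P₁, c₁ k₁ *
            ∑ b ∈ Ico b₀ (b₀ + L), eChar ((-(θ a k₁ k₂)) * b)‖
        ≤ ∑ k₂ ∈ range P, ‖c₂ k₂‖ * ∑ k₁ ∈ range P₁, ‖c₁ k₁‖ *
            ‖∑ b ∈ Ico b₀ (b₀ + L), eChar ((-(θ a k₁ k₂)) * b)‖ := by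
          refine (norm_sum_le _ _).trans (Finset.sum_le_sum fun k₂ _ => ?_)
          rw [norm_mul]
          gcongr
          refine (norm_sum_le _ _).trans (Finset.sum_le_sum fun k₁ _ => ?_)
          rw [norm_mul]
      _ ≤ ∑ k₂ ∈ range P, ‖c₂ k₂‖ * ∑ k₁ ∈ range P₁, B₁ * geomBound N (θ a k₁ k₂) := by
          gcongr with k₂ hk₂ k₁ hk₁
          · exact hB₁ k₁ hk₁
          · rw [← geomBound_neg]
            exact (norm_sum_Ico_eChar_le_geomBound' _ b₀ L).trans (geomBound_mono hL _)
      _ = B₁ * ∑ k₂ ∈ range P, ‖c₂ k₂‖ * ∑ k₁ ∈ range P₁, geomBound N (θ a k₁ k₂) := by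
          rw [Finset.mul_sum]
          refine Finset.sum_congr rfl fun k₂ _ => ?_
          rw [← Finset.mul_sum]; ring
  -- Step 3: sum over `a` and swap
  calc ∑ a ∈ 𝒜, |∑ b ∈ Ico b₀ (b₀ + L), f₁ (a * b) * f₂ (a * b)|
      ≤ ∑ a ∈ 𝒜, B₁ * ∑ k₂ ∈ range P, ‖c₂ k₂‖ * ∑ k₁ ∈ range P₁, geomBound N (θ a k₁ k₂) :=
        Finset.sum_le_sum fun a _ => hfix a
    _ = B₁ * ∑ k₂ ∈ range P, ‖c₂ k₂‖ * ∑ a ∈ 𝒜, ∑ k₁ ∈ range P₁, geomBound N (θ a k₁ k₂) := by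
        rw [← Finset.mul_sum, Finset.sum_comm]
        congr 1
        refine Finset.sum_congr rfl fun k₂ _ => ?_
        rw [Finset.mul_sum]
    _ ≤ B₁ * ∑ k₂ ∈ range P, ‖c₂ k₂‖ * W := by
        gcongr with k₂ hk₂
        exact hW k₂ hk₂
    _ = B₁ * (∑ k ∈ range P, ‖c₂ k‖) * W := by rw [← Finset.sum_mul]; ring

/-! ### Walsh functions on `ℕ`: bridge, digit split, Fourier expansion, sup norm -/

/-- The `Finset ℕ`-indexed Walsh character of `MoebiusWalshVaughan` is the `Fin n`-indexed one of
`MoebiusWalshLocalised` after `attachFin`. [folklore] -/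
theorem natWalsh_eq_walshNat (T : Finset ℕ) {n : ℕ} (h : ∀ t ∈ T, t < n) (x : ℕ) :
    natWalsh T x = walshNat (T.attachFin h) x := by
  calc natWalsh T x
      = ∏ t ∈ (T.attachFin h).map Fin.valEmbedding, (if x.testBit t = true then (-1 : ℝ) else 1) := by
        rw [Finset.map_valEmbedding_attachFin]; rfl
    _ = ∏ j ∈ T.attachFin h, (if x.testBit (j : ℕ) = true then (-1 : ℝ) else 1) := Finset.prod_map _ _ _
    _ = walshNat (T.attachFin h) x := (walshNat_eq_prod _ _).symm

/-- Splitting the digit set at height `m`: `w_T = w_{T ∩ [0,m)} · w_{T ∩ [m,∞)}` pointwise. [folklore] -/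
theorem natWalsh_eq_mul_filter (T : Finset ℕ) (m x : ℕ) :
    natWalsh T x = natWalsh (T.filter (· < m)) x * natWalsh (T.filter fun t => ¬ t < m) x := by
  unfold natWalsh
  rw [Finset.prod_filter_mul_prod_filter_not]

/-- **Fourier inversion for `natWalsh`**: for `T ⊆ [0, n)` and every `x ∈ ℕ`,
`w_T(x) = ∑_{k < 2ⁿ} ŵ_T(k/2ⁿ) e(-kx/2ⁿ)`. [cite: Bourgain2013MoebiusWalsh, Lemma 1] -/
theorem natWalsh_eq_sum_range (T : Finset ℕ) {n : ℕ} (h : ∀ t ∈ T, t < n) (x : ℕ) :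
    (natWalsh T x : ℂ) = ∑ k ∈ range (2 ^ n),
      walshCoeff (T.attachFin h) ((k : ℝ) / 2 ^ n) * eChar (-(k * ((x : ℝ) / 2 ^ n))) := by
  rw [natWalsh_eq_walshNat T h]
  exact walshNat_eq_sum_range _ x

/-- **Bourgain 2013, Lemma 2 with the explicit exponent**: `|ŵ_A(θ)| ≤ 2 · 2^{-c₂|A|}` for every
real `θ`, `c₂ = walshSupExponent = log₂(27/16)/4` (the tree's `bourgain2013_lemma2` packages the
same bound existentially). [cite: Bourgain2013MoebiusWalsh, Lemma 2 (1.3)] -/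
theorem norm_walshCoeff_le_two_mul_rpow {n : ℕ} (A : Finset (Fin n)) (θ : ℝ) :
    ‖walshCoeff A θ‖ ≤ 2 * (2 : ℝ) ^ (-(walshSupExponent * A.card)) := by
  set P := ‖walshCoeff A θ‖ with hP
  set Q : ℝ := (2 : ℝ) ^ (-(walshSupExponent * A.card)) with hQ
  have hP0 : 0 ≤ P := norm_nonneg _
  have hQ0 : 0 < Q := Real.rpow_pos_of_pos two_pos _
  have hQ4 : Q ^ 4 = (16 / 27 : ℝ) ^ A.card := by
    rw [hQ, ← Real.rpow_natCast, ← Real.rpow_mul (by norm_num : (0 : ℝ) ≤ 2),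
      show -(walshSupExponent * A.card) * ((4 : ℕ) : ℝ) = -(4 * walshSupExponent) * A.card by
        push_cast; ring,
      Real.rpow_mul (by norm_num : (0 : ℝ) ≤ 2), two_rpow_neg_four_mul_walshSupExponent,
      Real.rpow_natCast]
  have h4 : P ^ 4 ≤ (2 * Q) ^ 4 := by
    calc P ^ 4 ≤ (16 / 27 : ℝ) ^ (A.card - 1) := norm_walshCoeff_pow_four_le A θ
      _ ≤ 16 * (16 / 27 : ℝ) ^ A.card := by
          rcases Nat.eq_zero_or_pos A.card with h0 | hpos
          · rw [h0]; norm_num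
          · obtain ⟨m, hm⟩ := Nat.exists_eq_add_of_le hpos
            rw [hm, Nat.add_sub_cancel_left, pow_add, pow_one]
            have : 0 ≤ (16 / 27 : ℝ) ^ m := by positivity
            nlinarith [this]
      _ = (2 * Q) ^ 4 := by rw [mul_pow, hQ4]; norm_num
  exact (pow_le_pow_iff_left₀ hP0 (by positivity) (by norm_num)).1 h4

/-! ### The type-I estimate -/

/-- **Bourgain 2013, §3, the type-I estimate (master form).** For a digit set `T ⊆ [0, Λ)`, a cut
`Λ₁` (any natural number; `Λ₁ ≤ Λ` in the applications), `T₁ = T ∩ [0, Λ₁)`, `T₂ = T ∩ [Λ₁, Λ)`,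
and every box `D_i × D_j`
(`D_i = [2^i, 2^{i+1})`, `w_T = natWalsh T`):

  `∑_{a ∈ D_i} |∑_{b ∈ D_j} w_T(ab)| ≤ 2·2^{-c₂|T₁|} · (∑_{k<2^Λ} |ŵ_{T₂}(k/2^Λ)|) · (2^{i+j+1}(i+1) + 2^i 2^{Λ₁}(1 + log 2^{Λ₁}))`,

`c₂ = walshSupExponent`. This renders (3.2)–(3.2') (cut `Λ₁ = Λ`) and (3.7)–(3.9) (cut
`Λ₁ = λ - 2μ`, here `j - i`) of the paper in one statement, by the mollifier-free route described in
the module docstring (Fourier inversion for `w_{T₁}` mod `2^{Λ₁}` and `w_{T₂}` mod `2^Λ`, sup norm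
of `ŵ_{T₁}`, `ℓ¹` norm of `ŵ_{T₂}`, and pair counting `sum_dyBlock_sum_geomBound_le`).
[cite: Bourgain2013MoebiusWalsh, §3 (3.1)–(3.2'), (3.7)–(3.9)] -/
theorem typeI_master (T : Finset ℕ) (Λ₁ : ℕ) {Λ : ℕ} (hT : ∀ t ∈ T, t < Λ) (i j : ℕ) :
    ∑ a ∈ dyBlock i, |∑ b ∈ dyBlock j, natWalsh T (a * b)| ≤
      (2 * (2 : ℝ) ^ (-(walshSupExponent * ((T.filter (· < Λ₁)).card : ℝ)))) *
        (∑ k ∈ range (2 ^ Λ), ‖walshCoeff ((T.filter fun t => ¬ t < Λ₁).attachFin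
            (fun t ht => hT t (Finset.mem_filter.1 ht).1)) ((k : ℝ) / 2 ^ Λ)‖) *
        (2 * 2 ^ j * ((i + 1) * 2 ^ i) + 2 ^ i * (2 ^ Λ₁ * (1 + Real.log (2 ^ Λ₁)))) := by
  set T₁ : Finset ℕ := T.filter (· < Λ₁) with hT₁def
  set T₂ : Finset ℕ := T.filter fun t => ¬ t < Λ₁ with hT₂def
  have hT₁ : ∀ t ∈ T₁, t < Λ₁ := fun t ht => (Finset.mem_filter.1 ht).2
  have hT₂ : ∀ t ∈ T₂, t < Λ := fun t ht => hT t (Finset.mem_filter.1 ht).1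
  set A₁ : Finset (Fin Λ₁) := T₁.attachFin hT₁ with hA₁
  set A₂ : Finset (Fin Λ) := T₂.attachFin hT₂ with hA₂
  -- the pointwise split and the two Fourier expansions
  have hsplit : ∀ x, natWalsh T x = natWalsh T₁ x * natWalsh T₂ x := fun x =>
    natWalsh_eq_mul_filter T Λ₁ x
  set c₁ : ℕ → ℂ := fun k => walshCoeff A₁ ((k : ℝ) / 2 ^ Λ₁) with hc₁
  set c₂ : ℕ → ℂ := fun k => walshCoeff A₂ ((k : ℝ) / 2 ^ Λ) with hc₂
  have hf₁ : ∀ x : ℕ, (natWalsh T₁ x : ℂ) =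
      ∑ k ∈ range (2 ^ Λ₁), c₁ k * eChar (-(k * ((x : ℝ) / ((2 ^ Λ₁ : ℕ) : ℝ)))) := by
    intro x
    rw [natWalsh_eq_sum_range T₁ hT₁ x]
    push_cast
    rfl
  have hf₂ : ∀ x : ℕ, (natWalsh T₂ x : ℂ) =
      ∑ k ∈ range (2 ^ Λ), c₂ k * eChar (-(k * ((x : ℝ) / ((2 ^ Λ : ℕ) : ℝ)))) := by
    intro x
    rw [natWalsh_eq_sum_range T₂ hT₂ x]
    push_cast
    rfl
  -- the sup norm of `ŵ_{T₁}` (Lemma 2)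
  set B₁ : ℝ := 2 * (2 : ℝ) ^ (-(walshSupExponent * (T₁.card : ℝ))) with hB₁def
  have hB₁0 : 0 ≤ B₁ := by positivity
  have hB₁ : ∀ k ∈ range (2 ^ Λ₁), ‖c₁ k‖ ≤ B₁ := by
    intro k _
    have h := norm_walshCoeff_le_two_mul_rpow A₁ ((k : ℝ) / 2 ^ Λ₁)
    rwa [hA₁, Finset.card_attachFin] at h
  -- the box `D_j` as a block of length `2^j`
  have hDj : dyBlock j = Ico (2 ^ j) (2 ^ j + 2 ^ j) := by
    rw [dyBlock, pow_succ, mul_two]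
  have hL : (((2 ^ j : ℕ) : ℕ) : ℝ) ≤ (2 : ℝ) ^ j := by push_cast; exact le_rfl
  -- pair counting
  have hW : ∀ k₂ ∈ range (2 ^ Λ), ∑ a ∈ dyBlock i, ∑ k₁ ∈ range (2 ^ Λ₁),
      geomBound ((2 : ℝ) ^ j) ((a * k₁ : ℕ) / ((2 ^ Λ₁ : ℕ) : ℝ) + (a * k₂ : ℕ) / ((2 ^ Λ : ℕ) : ℝ)) ≤
      2 * (2 : ℝ) ^ j * ((i + 1) * 2 ^ i) + 2 ^ i * ((2 ^ Λ₁ : ℕ) * (1 + Real.log (2 ^ Λ₁ : ℕ))) :=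
    fun k₂ _ => sum_dyBlock_sum_geomBound_le i Λ₁ (fun a => (a * k₂ : ℕ) / ((2 ^ Λ : ℕ) : ℝ))
      (by positivity)
  have hmain := typeI_abstract (f₁ := natWalsh T₁) (f₂ := natWalsh T₂) (dyBlock i) (2 ^ j) (2 ^ j)
    hf₁ hf₂ hB₁0 hB₁ hL hW
  -- assemble
  calc ∑ a ∈ dyBlock i, |∑ b ∈ dyBlock j, natWalsh T (a * b)|
      = ∑ a ∈ dyBlock i, |∑ b ∈ Ico (2 ^ j) (2 ^ j + 2 ^ j), natWalsh T₁ (a * b) * natWalsh T₂ (a * b)| := by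
        simp_rw [← hsplit, hDj]
    _ ≤ B₁ * (∑ k ∈ range (2 ^ Λ), ‖c₂ k‖) *
          (2 * (2 : ℝ) ^ j * ((i + 1) * 2 ^ i) + 2 ^ i * ((2 ^ Λ₁ : ℕ) * (1 + Real.log (2 ^ Λ₁ : ℕ)))) :=
        hmain
    _ = _ := by push_cast; rfl

/-- **Bourgain 2013, §3, the type-I estimate (explicit form).** With `T`, `Λ₁`, `T₁`, `T₂` as
in `typeI_master`, the tree's Lemma 1 (`‖ŵ_{T₂}‖₁ ≤ (2Λ)^{|T₂|}`) makes the bound fully explicit: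

  `∑_{a ∈ D_i} |∑_{b ∈ D_j} w_T(ab)| ≤ 2·2^{-c₂|T₁|} (2Λ)^{|T₂|} (2^{i+j+1}(i+1) + 2^i 2^{Λ₁}(1 + log 2^{Λ₁}))`.

For the assembly of Theorem 1: with `M = 2^i`, `N = 2^j`, `MN ≍ 2^Λ`, the cut `Λ₁ = Λ` gives the
relative saving `≍ M Λ 2^{-c₂|T|}` of (3.2')–(3.3), and the cut `Λ₁ = j - i` (`2^{Λ₁} = N/M`) the
relative saving `≍ (i + Λ)(2Λ)^{|T ∩ [j-i, Λ)|} 2^{-c₂ |T ∩ [0, j-i)|}` of (3.8)–(3.9), free of the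
factor `M`. [cite: Bourgain2013MoebiusWalsh, §3 (3.3), (3.9)] -/
theorem typeI_bound (T : Finset ℕ) (Λ₁ : ℕ) {Λ : ℕ} (hT : ∀ t ∈ T, t < Λ) (i j : ℕ) :
    ∑ a ∈ dyBlock i, |∑ b ∈ dyBlock j, natWalsh T (a * b)| ≤
      (2 * (2 : ℝ) ^ (-(walshSupExponent * ((T.filter (· < Λ₁)).card : ℝ)))) *
        (2 * Λ : ℝ) ^ (T.filter fun t => ¬ t < Λ₁).card *
        (2 * 2 ^ j * ((i + 1) * 2 ^ i) + 2 ^ i * (2 ^ Λ₁ * (1 + Real.log (2 ^ Λ₁)))) := by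
  refine (typeI_master T Λ₁ hT i j).trans ?_
  have hlog : 0 ≤ 1 + Real.log ((2 : ℝ) ^ Λ₁) := by
    have := Real.log_nonneg (one_le_pow₀ (M₀ := ℝ) one_le_two (n := Λ₁)); linarith
  gcongr
  have h := bourgain2013_lemma1 ((T.filter fun t => ¬ t < Λ₁).attachFin
    (fun t ht => hT t (Finset.mem_filter.1 ht).1))
  rwa [Finset.card_attachFin] at h

/-- **The crude regime** (Bourgain 2013, (3.2)–(3.3)): cut `Λ₁ = Λ`, no top digits.
`∑_{a ∈ D_i} |∑_{b ∈ D_j} w_T(ab)| ≤ 2·2^{-c₂|T|} (2^{i+j+1}(i+1) + 2^{i+Λ}(1 + log 2^Λ))`.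
[cite: Bourgain2013MoebiusWalsh, §3 (3.2'), (3.3)] -/
theorem typeI_crude (T : Finset ℕ) {Λ : ℕ} (hT : ∀ t ∈ T, t < Λ) (i j : ℕ) :
    ∑ a ∈ dyBlock i, |∑ b ∈ dyBlock j, natWalsh T (a * b)| ≤
      (2 * (2 : ℝ) ^ (-(walshSupExponent * (T.card : ℝ)))) *
        (2 * 2 ^ j * ((i + 1) * 2 ^ i) + 2 ^ i * (2 ^ Λ * (1 + Real.log (2 ^ Λ)))) := by
  have h := typeI_bound T Λ hT i j
  have h1 : T.filter (· < Λ) = T := Finset.filter_true_of_mem hT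
  have h2 : (T.filter fun t => ¬ t < Λ) = ∅ := by
    rw [Finset.filter_eq_empty_iff]
    intro t ht hnot
    exact hnot (hT t ht)
  rw [h1, h2, Finset.card_empty, pow_zero, mul_one] at h
  exact h

/-- **The refined regime** (Bourgain 2013, (3.5)–(3.9)): for `i ≤ j`, cut at `Λ₁ = j - i`, so
that `2^{Λ₁} 2^i = 2^j`:
`∑_{a ∈ D_i} |∑_{b ∈ D_j} w_T(ab)| ≤ 2·2^{-c₂|T ∩ [0,j-i)|} (2Λ)^{|T ∩ [j-i,Λ)|} 2^j (2^{i+1}(i+1) + 1 + log 2^{j-i})`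
— the saving carries no factor `2^i = M`. [cite: Bourgain2013MoebiusWalsh, §3 (3.8)–(3.9)] -/
theorem typeI_refined (T : Finset ℕ) {Λ : ℕ} (hT : ∀ t ∈ T, t < Λ) {i j : ℕ} (hij : i ≤ j) :
    ∑ a ∈ dyBlock i, |∑ b ∈ dyBlock j, natWalsh T (a * b)| ≤
      (2 * (2 : ℝ) ^ (-(walshSupExponent * ((T.filter (· < j - i)).card : ℝ)))) *
        (2 * Λ : ℝ) ^ (T.filter fun t => ¬ t < j - i).card *
        (2 ^ j * (2 * ((i + 1) * 2 ^ i) + (1 + Real.log (2 ^ (j - i))))) := by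
  have h := typeI_bound T (j - i) hT i j
  have hpow : (2 : ℝ) ^ i * 2 ^ (j - i) = 2 ^ j := by
    rw [← pow_add]; congr 1; omega
  calc _ ≤ _ := h
    _ = _ := by rw [← hpow]; ring

/-! ### Removing the divisor-bounded type-I coefficient -/

open Literature.NumberTheory.LFunctions.MoebiusWalshVaughan (typeICoeff abs_typeICoeff_le) in
/-- **The type-I box sum of the Vaughan reduction** (`boxSum T i j (typeICoeff u) 1 =
∑_{a ∈ D_i} c(a) ∑_{b ∈ D_j} w_T(ab)`, `|c| ≤ τ`) against a bound `F` for
`∑_{a ∈ D_i} |∑_{b ∈ D_j} w_T(ab)|`: by Cauchy–Schwarz and the divisor mean square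
`∑_{a ≤ 2^{i+1}} τ(a)² ≤ 2^{i+1}(1 + log 2^{i+1})³` (tree),
`|boxSum| ≤ √(2^{i+1}(1 + log 2^{i+1})³) · √(2^j F)`. [cite: Bourgain2013MoebiusWalsh, §3 (3.1)] -/
theorem abs_boxSum_typeI_le (T : Finset ℕ) (i j u : ℕ) {F : ℝ}
    (hF : ∑ a ∈ dyBlock i, |∑ b ∈ dyBlock j, natWalsh T (a * b)| ≤ F) :
    |boxSum T i j (typeICoeff u) (fun _ => 1)| ≤
      Real.sqrt (2 ^ (i + 1) * (1 + Real.log (2 ^ (i + 1))) ^ 3) * Real.sqrt (2 ^ j * F) := by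
  set G : ℕ → ℝ := fun a => ∑ b ∈ dyBlock j, natWalsh T (a * b) with hG
  have hbox : boxSum T i j (typeICoeff u) (fun _ => 1) = ∑ a ∈ dyBlock i, typeICoeff u a * G a := by
    unfold boxSum
    refine Finset.sum_congr rfl fun a _ => ?_
    rw [hG, Finset.mul_sum]
    refine Finset.sum_congr rfl fun b _ => ?_
    ring
  have hGle : ∀ a, |G a| ≤ 2 ^ j := by
    intro a
    calc |G a| ≤ ∑ b ∈ dyBlock j, |natWalsh T (a * b)| := Finset.abs_sum_le_sum_abs _ _
      _ ≤ ∑ _b ∈ dyBlock j, (1 : ℝ) := Finset.sum_le_sum fun b _ =>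
          MoebiusWalshVaughan.abs_natWalsh_le T _
      _ = 2 ^ j := by
          have : 2 ^ (j + 1) - 2 ^ j = 2 ^ j := by rw [pow_succ]; omega
          rw [Finset.sum_const, dyBlock, Nat.card_Ico, this]; simp
  -- Cauchy–Schwarz
  have hCS : (∑ a ∈ dyBlock i, |typeICoeff u a| * |G a|) ^ 2 ≤
      (∑ a ∈ dyBlock i, |typeICoeff u a| ^ 2) * ∑ a ∈ dyBlock i, |G a| ^ 2 :=
    Finset.sum_mul_sq_le_sq_mul_sq _ _ _
  -- the divisor mean square
  have hτ : ∑ a ∈ dyBlock i, |typeICoeff u a| ^ 2 ≤ 2 ^ (i + 1) * (1 + Real.log (2 ^ (i + 1))) ^ 3 := by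
    calc ∑ a ∈ dyBlock i, |typeICoeff u a| ^ 2
        ≤ ∑ a ∈ dyBlock i, ((Nat.card (Nat.divisors a) : ℕ) : ℝ) ^ 2 := by
          refine Finset.sum_le_sum fun a _ => ?_
          have h1 := abs_typeICoeff_le u a
          rw [ArithmeticFunction.sigma_zero_apply] at h1
          rw [Nat.card_eq_finsetCard]
          exact pow_le_pow_left₀ (abs_nonneg _) h1 2
      _ ≤ ∑ a ∈ Ioc 0 (2 ^ (i + 1)), ((Nat.card (Nat.divisors a) : ℕ) : ℝ) ^ 2 := by
          refine Finset.sum_le_sum_of_subset_of_nonneg ?_ fun a _ _ => by positivity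
          intro a ha
          rw [mem_dyBlock] at ha
          rw [Finset.mem_Ioc]
          have := Nat.two_pow_pos i
          omega
      _ ≤ (2 ^ (i + 1) : ℕ) * (1 + Real.log (2 ^ (i + 1) : ℕ)) ^ 3 := by
          have h := Literature.NumberTheory.Sieve.Vaughan.sum_sq_card_divisors_le (2 ^ (i + 1))
          simp only [Nat.card_eq_finsetCard]
          exact h
      _ = 2 ^ (i + 1) * (1 + Real.log (2 ^ (i + 1))) ^ 3 := by push_cast; ring
  have hG2 : ∑ a ∈ dyBlock i, |G a| ^ 2 ≤ 2 ^ j * F := by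
    calc ∑ a ∈ dyBlock i, |G a| ^ 2 ≤ ∑ a ∈ dyBlock i, 2 ^ j * |G a| := by
          refine Finset.sum_le_sum fun a _ => ?_
          rw [sq]
          exact mul_le_mul_of_nonneg_right (hGle a) (abs_nonneg _)
      _ = 2 ^ j * ∑ a ∈ dyBlock i, |G a| := by rw [Finset.mul_sum]
      _ ≤ 2 ^ j * F := by gcongr
  have hlhs : |boxSum T i j (typeICoeff u) (fun _ => 1)| ≤ ∑ a ∈ dyBlock i, |typeICoeff u a| * |G a| := by
    rw [hbox]
    refine (Finset.abs_sum_le_sum_abs _ _).trans ?_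
    refine Finset.sum_le_sum fun a _ => ?_
    rw [abs_mul]
  have hnonneg : 0 ≤ ∑ a ∈ dyBlock i, |typeICoeff u a| * |G a| :=
    Finset.sum_nonneg fun a _ => by positivity
  have hlog : 0 ≤ 1 + Real.log ((2 : ℝ) ^ (i + 1)) := by
    have := Real.log_nonneg (one_le_pow₀ (M₀ := ℝ) one_le_two (n := i + 1)); linarith
  have hconst : 0 ≤ (2 : ℝ) ^ (i + 1) * (1 + Real.log (2 ^ (i + 1))) ^ 3 :=
    mul_nonneg (by positivity) (pow_nonneg hlog 3)
  refine hlhs.trans ?_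
  rw [← Real.sqrt_mul hconst, ← Real.sqrt_sq hnonneg]
  refine Real.sqrt_le_sqrt ?_
  calc (∑ a ∈ dyBlock i, |typeICoeff u a| * |G a|) ^ 2
      ≤ (∑ a ∈ dyBlock i, |typeICoeff u a| ^ 2) * ∑ a ∈ dyBlock i, |G a| ^ 2 := hCS
    _ ≤ (2 ^ (i + 1) * (1 + Real.log (2 ^ (i + 1))) ^ 3) * (2 ^ j * F) := by
        refine mul_le_mul hτ hG2 (Finset.sum_nonneg fun a _ => by positivity) hconst

end Literature.NumberTheory.LFunctions.MoebiusWalsh
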